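import Mathlib
import HarnessLib

/-!
# Fluid computer — ODE comparison for the cubic enstrophy law (support file of the SPEED LIMIT, L24)

HONEST FRAMING (cell `pub-fluidc`, verbatim): *low prior, high value-of-information experiment on Tao's
machine paradigm; NOT a claim that NS blows up.* Pure real analysis; nothing about the Navier–Stokes equations.

The comparison principle behind Leray's `H¹` theory (Robinson–Rodrigo–Sadowski 2016, (6.8)–(6.9): comparison of
`X' ≤ c X³` with the Bernoulli equation `Y' = c Y³`), in the INTEGRAL form in which the tree states the cubic
enstrophy inequality (`exists_enstrophy_cubic_ineq`: `G(b) ≤ G(0) + L ∫₀ᵇ G³`):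

* `sq_mul_le_of_cubic` — if `G ≥ 0` is continuous on `[0, b₀]`, `G(0) > 0`, `L ≥ 0` and
  `G(b) ≤ G(0) + L ∫₀ᵇ G³` for all `b ∈ [0, b₀]`, then `G(b)² (1 − 2 L G(0)² b) ≤ G(0)²` for all `b ∈ [0, b₀]`:
  as long as `2 L G(0)² b < 1` the solution stays below the Bernoulli blow-up profile
  `G(0)/√(1 − 2 L G(0)² b)`. Proof: `H(b) = G(0) + L∫₀ᵇ G³ ≥ G(b)` has `H' = L G³ ≤ L H³`, so
  `−1/(2H²)` has derivative `≤ L` (mean value inequality).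

0 sorry; no definitions, no named facts.

## References

* J. C. Robinson, J. L. Rodrigo, W. Sadowski, *The Three-Dimensional Navier–Stokes Equations*, CUP 2016,
  Thm. 6.8 (proof, (6.8)–(6.9)) and Lemma 6.11. [RobinsonRodrigoSadowski2016]
-/

noncomputable section

open MeasureTheory Set Filter Topology intervalIntegral

namespace Summit.NavierStokesRegularity.FluidComputer.EnstrophyComparison

/-- **Comparison for the cubic integral inequality (Bernoulli majorant).** Let `G` be continuous and
nonnegative on `[0, b₀]` with `G(0) > 0`, let `L ≥ 0`, and suppose `G(b) ≤ G(0) + L ∫₀ᵇ G(t)³ dt` for every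
`b ∈ [0, b₀]`. Then `G(b)² · (1 − 2 L G(0)² b) ≤ G(0)²` for every `b ∈ [0, b₀]` — i.e. `G(b) ≤ G(0)/√(1 − 2LG(0)²b)`
while `2 L G(0)² b < 1` (and trivially otherwise). [cite: RobinsonRodrigoSadowski2016, Thm. 6.8 (proof, (6.8)-(6.9))] -/
theorem sq_mul_le_of_cubic {G : ℝ → ℝ} {L b₀ : ℝ} (hL : 0 ≤ L) (hb₀ : 0 < b₀)
    (hGc : ContinuousOn G (Icc 0 b₀)) (hG0 : ∀ t ∈ Icc 0 b₀, 0 ≤ G t) (hpos : 0 < G 0)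
    (hineq : ∀ b ∈ Icc 0 b₀, G b ≤ G 0 + L * ∫ t in (0 : ℝ)..b, G t ^ 3) :
    ∀ b ∈ Icc 0 b₀, G b ^ 2 * (1 - 2 * L * G 0 ^ 2 * b) ≤ G 0 ^ 2 := by
  intro b hb
  -- the majorant `H(t) = G(0) + L ∫₀ᵗ G³`
  set H : ℝ → ℝ := fun t => G 0 + L * ∫ s in (0 : ℝ)..t, G s ^ 3 with hH
  have hG3c : ContinuousOn (fun s => G s ^ 3) (Icc 0 b₀) := hGc.pow 3
  have hint : ∀ t ∈ Icc 0 b₀, IntervalIntegrable (fun s => G s ^ 3) volume 0 t := fun t ht =>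
    (hG3c.mono (Icc_subset_Icc le_rfl ht.2)).intervalIntegrable_of_Icc ht.1
  have hGH : ∀ t ∈ Icc 0 b₀, G t ≤ H t := fun t ht => hineq t ht
  have hH0 : H 0 = G 0 := by simp [hH]
  have hHge : ∀ t ∈ Icc 0 b₀, G 0 ≤ H t := by
    intro t ht
    have h0 : 0 ≤ ∫ s in (0 : ℝ)..t, G s ^ 3 :=
      intervalIntegral.integral_nonneg ht.1 fun s hs => pow_nonneg (hG0 s ⟨hs.1, hs.2.trans ht.2⟩) 3
    have : 0 ≤ L * ∫ s in (0 : ℝ)..t, G s ^ 3 := mul_nonneg hL h0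
    simp only [hH]
    linarith
  have hHpos : ∀ t ∈ Icc 0 b₀, 0 < H t := fun t ht => hpos.trans_le (hHge t ht)
  -- continuity of `H` on `[0, b₀]`
  have hHc : ContinuousOn H (Icc 0 b₀) := by
    have hprim : ContinuousOn (fun t => ∫ s in (0 : ℝ)..t, G s ^ 3) (Icc 0 b₀) := by
      have hIo : IntegrableOn (fun s => G s ^ 3) (uIcc 0 b₀) volume := by
        rw [uIcc_of_le hb₀.le]
        exact hG3c.integrableOn_Icc
      have h := intervalIntegral.continuousOn_primitive_interval hIo
      rwa [uIcc_of_le hb₀.le] at h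
    exact continuousOn_const.add (continuousOn_const.mul hprim)
  -- derivative of `H` in the interior
  have hHd : ∀ t ∈ Ioo 0 b₀, HasDerivAt H (L * G t ^ 3) t := by
    intro t ht
    have htI : t ∈ Icc 0 b₀ := Ioo_subset_Icc_self ht
    have hca : ContinuousAt (fun s => G s ^ 3) t := hG3c.continuousAt (Icc_mem_nhds ht.1 ht.2)
    have hmeas : StronglyMeasurableAtFilter (fun s => G s ^ 3) (𝓝 t) volume :=
      (hG3c.mono Ioo_subset_Icc_self).stronglyMeasurableAtFilter isOpen_Ioo t ht
    have h1 : HasDerivAt (fun u => ∫ s in (0 : ℝ)..u, G s ^ 3) (G t ^ 3) t :=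
      intervalIntegral.integral_hasDerivAt_right (hint t htI) hmeas hca
    have h2 := (h1.const_mul L).const_add (G 0)
    exact h2
  -- the function `φ = -1/(2H²)` and its derivative `L G³/H³ ≤ L`
  set φ : ℝ → ℝ := fun t => -(2 * H t ^ 2)⁻¹ with hφ
  have hφd : ∀ t ∈ Ioo 0 b₀, HasDerivAt φ (L * G t ^ 3 / H t ^ 3) t := by
    intro t ht
    have hHt : 0 < H t := hHpos t (Ioo_subset_Icc_self ht)
    have hne : 2 * H t ^ 2 ≠ 0 := by positivity
    have h1 : HasDerivAt (fun s => 2 * H s ^ 2) (2 * ((2 : ℕ) * H t ^ (2 - 1) * (L * G t ^ 3))) t :=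
      ((hHd t ht).pow 2).const_mul 2
    have h2 := (h1.inv hne).neg
    refine h2.congr_deriv ?_
    field_simp
    push_cast
    ring
  have hφle : ∀ t ∈ Ioo 0 b₀, L * G t ^ 3 / H t ^ 3 ≤ L := by
    intro t ht
    have htI : t ∈ Icc 0 b₀ := Ioo_subset_Icc_self ht
    have hHt : 0 < H t := hHpos t htI
    have hq : G t / H t ≤ 1 := (div_le_one hHt).2 (hGH t htI)
    have hq0 : 0 ≤ G t / H t := div_nonneg (hG0 t htI) hHt.le
    have hq3 : (G t / H t) ^ 3 ≤ 1 := pow_le_one₀ hq0 hq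
    calc L * G t ^ 3 / H t ^ 3 = L * (G t / H t) ^ 3 := by rw [div_pow]; ring
      _ ≤ L * 1 := mul_le_mul_of_nonneg_left hq3 hL
      _ = L := mul_one L
  -- mean value inequality on `[0, b]`
  have hφc : ContinuousOn φ (Icc 0 b) := by
    have hHc' : ContinuousOn H (Icc 0 b) := hHc.mono (Icc_subset_Icc le_rfl hb.2)
    refine ((continuousOn_const.mul (hHc'.pow 2)).inv₀ fun t ht => ?_).neg
    have := hHpos t ⟨ht.1, ht.2.trans hb.2⟩
    exact mul_ne_zero two_ne_zero (pow_ne_zero 2 this.ne')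
  have hφdiff : DifferentiableOn ℝ φ (interior (Icc 0 b)) := by
    rw [interior_Icc]
    intro t ht
    exact (hφd t ⟨ht.1, ht.2.trans_le hb.2⟩).differentiableAt.differentiableWithinAt
  have hφ' : ∀ t ∈ interior (Icc 0 b), deriv φ t ≤ L := by
    rw [interior_Icc]
    intro t ht
    have ht' : t ∈ Ioo 0 b₀ := ⟨ht.1, ht.2.trans_le hb.2⟩
    rw [(hφd t ht').deriv]
    exact hφle t ht'
  have hmv := (convex_Icc 0 b).image_sub_le_mul_sub_of_deriv_le hφc hφdiff hφ' 0 (left_mem_Icc.2 hb.1) b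
    (right_mem_Icc.2 hb.1) hb.1
  -- `φ b - φ 0 ≤ L b`, i.e. `1/(2 G(0)²) - 1/(2 H(b)²) ≤ L b`
  have hHb : 0 < H b := hHpos b hb
  have hφ0 : φ 0 = -(2 * G 0 ^ 2)⁻¹ := by simp only [hφ, hH0]
  have hφb : φ b = -(2 * H b ^ 2)⁻¹ := rfl
  rw [hφ0, hφb, sub_zero] at hmv
  -- conclude
  by_cases hD : 1 - 2 * L * G 0 ^ 2 * b ≤ 0
  · calc G b ^ 2 * (1 - 2 * L * G 0 ^ 2 * b) ≤ 0 := mul_nonpos_of_nonneg_of_nonpos (sq_nonneg _) hD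
      _ ≤ G 0 ^ 2 := sq_nonneg _
  · rw [not_le] at hD
    have hG2 : 0 < G 0 ^ 2 := by positivity
    have hH2 : 0 < H b ^ 2 := by positivity
    -- from the mean value inequality: `(1 - 2 L G(0)² b) · H(b)² ≤ G(0)²`
    have key : (1 - 2 * L * G 0 ^ 2 * b) * H b ^ 2 ≤ G 0 ^ 2 := by
      have h1 : (2 * G 0 ^ 2)⁻¹ - L * b ≤ (2 * H b ^ 2)⁻¹ := by linarith
      have h2 : (1 - 2 * L * G 0 ^ 2 * b) / (2 * G 0 ^ 2) ≤ 1 / (2 * H b ^ 2) := by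
        have e1 : (1 - 2 * L * G 0 ^ 2 * b) / (2 * G 0 ^ 2) = (2 * G 0 ^ 2)⁻¹ - L * b := by
          field_simp
        rw [e1, one_div]
        exact h1
      rw [div_le_div_iff₀ (by positivity) (by positivity)] at h2
      nlinarith [h2]
    have hGb : G b ^ 2 ≤ H b ^ 2 := pow_le_pow_left₀ (hG0 b hb) (hGH b hb) 2
    calc G b ^ 2 * (1 - 2 * L * G 0 ^ 2 * b) ≤ H b ^ 2 * (1 - 2 * L * G 0 ^ 2 * b) :=
          mul_le_mul_of_nonneg_right hGb hD.le
      _ = (1 - 2 * L * G 0 ^ 2 * b) * H b ^ 2 := by ring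
      _ ≤ G 0 ^ 2 := key

end Summit.NavierStokesRegularity.FluidComputer.EnstrophyComparison

end
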